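import Mathlib
import Summits.AtomisticToContinuum.FouriersLaw.Theorems.EmbeddedDrudeMourreDrudeDissolutionFloorGlobal
import Summits.AtomisticToContinuum.FouriersLaw.Theorems.EmbeddedDrudeMourreDrudeDissolutionOmegaStructureBounds
import Summits.AtomisticToContinuum.FouriersLaw.Theorems.EmbeddedDrudeMourreDrudeDissolutionCutoffProducts
import HarnessLib

/-!
# The five cutoff arguments `ρ₁,…,ρ₅` of the sup-norm route: regularity, periodicity, derivative bounds, zeros
(crux `EmbeddedDrudeMourre.DrudeDissolution`, item stmt-AtomisticToContinuum-12593; `--supports` file for the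
registered sub-goal `cutoff_arguments` of stub B1b″ `stub_excursionSecondDifference` of line
`kinetic-polymer-gas-on-the-time-axis`; closes nothing; lead c13 (process B), 2026-08-17)

WHAT. The cutoff `Θ_η = ∏ₖ ζ(ρₖ/η²)` of the sup-norm route uses the five squared distances
`ρ₁ = S₁² + A²`, `ρ₂ = S₂² + A²`, `ρ₃ = S₁² + S₂²` (to the two co-moving curves and the diagonal) and
`ρ₄ = d₋ = (1−cos k₁)+(1−cos k₂)+(1+cos k₃)`, `ρ₅ = d₊` (to the two corner lattices), read at `p = (k₁,(k₃,k₂))`.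
We prove, along any admissible frame (`|(eᵢ)ⱼ| ≤ 1`, half-differences `≤ 1`):
* `cornerDist_bounds`: `d_σ = 3 + σ₁cos k₁ + σ₂cos k₂ + σ₃cos k₃` (`σᵢ = ±1`) is `C²`, `≥ 0`, with
  `(∂d)² ≤ 6d` and `|∂²d| ≤ 3`;
* `cutoff_arguments` (registered): common constants `K, K₂` with `ρₖ ∈ C²`, `ρₖ ≥ 0`, `2π`-periodic in each
  coordinate, `(∂_{eᵢ}ρₖ)² ≤ K ρₖ`, `|∂_{eⱼ}∂_{eᵢ}ρₖ| ≤ K₂` for all five `k`, and the zero structure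
  `D(p) = 0 ⇒ ρₖ(p) = 0` for some `k` (from `resonance_gradient_floor`).

WHY (role). Inputs of `cutoff_scale_bounds_gen` / `cutoff_vanishes_near` for the cutoff family (item (C5) of
the remaining concrete work for B1b″).
-/

noncomputable section

open scoped Topology
open Filter Set

namespace Summit.AtomisticToContinuum.FouriersLaw.Theorems.DrudeDissolution.KineticPolymerGasOnTheTimeAxis

open Literature.MathematicalPhysics.KineticTheory
open Literature.MathematicalPhysics.KineticTheory.PhononBoltzmann

/-! ### The corner distances -/

/-- **Corner distance bounds.** For signs `σᵢ` (`σᵢ² = 1`), `d(p) = 3 + σ₁cos p.1 + σ₂cos p.2.2 + σ₃cos p.2.1` is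
`C²` and nonnegative, and along directions with coordinates bounded by `1`: `(∂ᵥd)² ≤ 6d`, `|∂_w∂ᵥd| ≤ 3`.
[folklore] -/
theorem cornerDist_bounds (σ₁ σ₂ σ₃ : ℝ) (h₁ : σ₁ ^ 2 = 1) (h₂ : σ₂ ^ 2 = 1) (h₃ : σ₃ ^ 2 = 1)
    (d : ℝ × ℝ × ℝ → ℝ) (hd : ∀ p, d p = 3 + σ₁ * Real.cos p.1 + σ₂ * Real.cos p.2.2 + σ₃ * Real.cos p.2.1)
    (v w p : ℝ × ℝ × ℝ) (hv : |v.1| ≤ 1 ∧ |v.2.1| ≤ 1 ∧ |v.2.2| ≤ 1) (hw : |w.1| ≤ 1 ∧ |w.2.1| ≤ 1 ∧ |w.2.2| ≤ 1) :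
    ContDiff ℝ 2 d ∧ 0 ≤ d p ∧ (fderiv ℝ d p v) ^ 2 ≤ 6 * d p ∧
      |fderiv ℝ (fun q => fderiv ℝ d q v) p w| ≤ 3 := by
  have hσ₁ : σ₁ = 1 ∨ σ₁ = -1 := by
    have : (σ₁ - 1) * (σ₁ + 1) = 0 := by linear_combination h₁
    rcases mul_eq_zero.1 this with h | h <;> [left; right] <;> linarith
  have hσ₂ : σ₂ = 1 ∨ σ₂ = -1 := by
    have : (σ₂ - 1) * (σ₂ + 1) = 0 := by linear_combination h₂
    rcases mul_eq_zero.1 this with h | h <;> [left; right] <;> linarith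
  have hσ₃ : σ₃ = 1 ∨ σ₃ = -1 := by
    have : (σ₃ - 1) * (σ₃ + 1) = 0 := by linear_combination h₃
    rcases mul_eq_zero.1 this with h | h <;> [left; right] <;> linarith
  have aσ₁ : |σ₁| = 1 := by rcases hσ₁ with h | h <;> simp [h]
  have aσ₂ : |σ₂| = 1 := by rcases hσ₂ with h | h <;> simp [h]
  have aσ₃ : |σ₃| = 1 := by rcases hσ₃ with h | h <;> simp [h]
  -- the three projections as CLMs
  set P₁ : ℝ × ℝ × ℝ →L[ℝ] ℝ := ContinuousLinearMap.fst ℝ ℝ (ℝ × ℝ) with hP₁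
  set P₂ : ℝ × ℝ × ℝ →L[ℝ] ℝ := (ContinuousLinearMap.snd ℝ ℝ ℝ).comp (ContinuousLinearMap.snd ℝ ℝ (ℝ × ℝ)) with hP₂
  set P₃ : ℝ × ℝ × ℝ →L[ℝ] ℝ := (ContinuousLinearMap.fst ℝ ℝ ℝ).comp (ContinuousLinearMap.snd ℝ ℝ (ℝ × ℝ)) with hP₃
  have dfun : d = fun q => 3 + σ₁ * Real.cos (P₁ q) + σ₂ * Real.cos (P₂ q) + σ₃ * Real.cos (P₃ q) := by
    funext q; rw [hd]; simp [hP₁, hP₂, hP₃]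
  -- smoothness
  have hdC : ContDiff ℝ 2 d := by
    rw [dfun]
    exact ((contDiff_const.add (contDiff_const.mul (Real.contDiff_cos.comp P₁.contDiff))).add
      (contDiff_const.mul (Real.contDiff_cos.comp P₂.contDiff))).add
      (contDiff_const.mul (Real.contDiff_cos.comp P₃.contDiff))
  -- first derivative
  have hD1 : ∀ q, HasFDerivAt d (σ₁ • ((-Real.sin (P₁ q)) • P₁) + σ₂ • ((-Real.sin (P₂ q)) • P₂) +
      σ₃ • ((-Real.sin (P₃ q)) • P₃)) q := fun q => by
    rw [dfun]
    have c1 := ((Real.hasDerivAt_cos (P₁ q)).comp_hasFDerivAt q P₁.hasFDerivAt).const_smul σ₁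
    have c2 := ((Real.hasDerivAt_cos (P₂ q)).comp_hasFDerivAt q P₂.hasFDerivAt).const_smul σ₂
    have c3 := ((Real.hasDerivAt_cos (P₃ q)).comp_hasFDerivAt q P₃.hasFDerivAt).const_smul σ₃
    have h := (((hasFDerivAt_const (3 : ℝ) q).add c1).add c2).add c3
    simp only [zero_add] at h
    convert h using 1 <;> rfl
  have hf1 : ∀ q u, fderiv ℝ d q u = -(σ₁ * Real.sin (P₁ q) * P₁ u) - σ₂ * Real.sin (P₂ q) * P₂ u -
      σ₃ * Real.sin (P₃ q) * P₃ u := fun q u => by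
    rw [(hD1 q).fderiv]
    simp only [add_apply, smul_apply, smul_eq_mul]
    ring
  -- second derivative
  have gfun : (fun q => fderiv ℝ d q v) = fun q => -(σ₁ * P₁ v) * Real.sin (P₁ q) - (σ₂ * P₂ v) * Real.sin (P₂ q) -
      (σ₃ * P₃ v) * Real.sin (P₃ q) := by
    funext q; rw [hf1]; ring
  have hD2 : HasFDerivAt (fun q => fderiv ℝ d q v)
      (-(σ₁ * P₁ v) • (Real.cos (P₁ p) • P₁) - (σ₂ * P₂ v) • (Real.cos (P₂ p) • P₂) -
        (σ₃ * P₃ v) • (Real.cos (P₃ p) • P₃)) p := by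
    rw [gfun]
    have s1 := ((Real.hasDerivAt_sin (P₁ p)).comp_hasFDerivAt p P₁.hasFDerivAt).const_smul (-(σ₁ * P₁ v))
    have s2 := ((Real.hasDerivAt_sin (P₂ p)).comp_hasFDerivAt p P₂.hasFDerivAt).const_smul (σ₂ * P₂ v)
    have s3 := ((Real.hasDerivAt_sin (P₃ p)).comp_hasFDerivAt p P₃.hasFDerivAt).const_smul (σ₃ * P₃ v)
    have h := (s1.sub s2).sub s3
    convert h using 1 <;> rfl
  have hf2 : fderiv ℝ (fun q => fderiv ℝ d q v) p w = -(σ₁ * P₁ v) * (Real.cos (P₁ p) * P₁ w) -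
      (σ₂ * P₂ v) * (Real.cos (P₂ p) * P₂ w) - (σ₃ * P₃ v) * (Real.cos (P₃ p) * P₃ w) := by
    rw [hD2.fderiv]
    simp only [sub_apply, smul_apply, smul_eq_mul]
  -- values of the projections on `v`, `w`
  have eP : ∀ u : ℝ × ℝ × ℝ, P₁ u = u.1 ∧ P₂ u = u.2.2 ∧ P₃ u = u.2.1 := fun u => by simp [hP₁, hP₂, hP₃]
  obtain ⟨ev1, ev2, ev3⟩ := eP v
  obtain ⟨ew1, ew2, ew3⟩ := eP w
  obtain ⟨ep1, ep2, ep3⟩ := eP p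
  have hv1 : |P₁ v| ≤ 1 := by rw [ev1]; exact hv.1
  have hv2 : |P₂ v| ≤ 1 := by rw [ev2]; exact hv.2.2
  have hv3 : |P₃ v| ≤ 1 := by rw [ev3]; exact hv.2.1
  have hw1 : |P₁ w| ≤ 1 := by rw [ew1]; exact hw.1
  have hw2 : |P₂ w| ≤ 1 := by rw [ew2]; exact hw.2.2
  have hw3 : |P₃ w| ≤ 1 := by rw [ew3]; exact hw.2.1
  -- nonnegativity and `sin² ≤ 2(1 + σ cos)`
  have hcos1 := Real.abs_cos_le_one (P₁ p)
  have hcos2 := Real.abs_cos_le_one (P₂ p)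
  have hcos3 := Real.abs_cos_le_one (P₃ p)
  have key : ∀ (σ x : ℝ), |σ| = 1 → 0 ≤ 1 + σ * Real.cos x ∧ Real.sin x ^ 2 ≤ 2 * (1 + σ * Real.cos x) := by
    intro σ x hσ
    have hc := Real.abs_cos_le_one x
    have hsc : |σ * Real.cos x| ≤ 1 := by rw [abs_mul, hσ, one_mul]; exact hc
    have h1 := (abs_le.1 hsc).1
    have hs : Real.sin x ^ 2 = (1 - σ * Real.cos x) * (1 + σ * Real.cos x) := by
      have hσ2 : σ ^ 2 = 1 := by rw [← sq_abs, hσ, one_pow]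
      rw [show (1 - σ * Real.cos x) * (1 + σ * Real.cos x) = 1 - σ ^ 2 * Real.cos x ^ 2 by ring, hσ2, one_mul]
      linarith [Real.sin_sq_add_cos_sq x]
    refine ⟨by linarith, ?_⟩
    rw [hs]
    have h2 := (abs_le.1 hsc).2
    exact mul_le_mul_of_nonneg_right (by linarith) (by linarith)
  obtain ⟨n1, s1⟩ := key σ₁ (P₁ p) aσ₁
  obtain ⟨n2, s2⟩ := key σ₂ (P₂ p) aσ₂
  obtain ⟨n3, s3⟩ := key σ₃ (P₃ p) aσ₃
  have hdp : d p = 3 + σ₁ * Real.cos (P₁ p) + σ₂ * Real.cos (P₂ p) + σ₃ * Real.cos (P₃ p) := by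
    rw [dfun]
  refine ⟨hdC, by rw [hdp]; linarith, ?_, ?_⟩
  · -- `(∂ᵥd)² ≤ 3 Σ sin² ≤ 6 d`
    rw [hf1]
    have b1 : |σ₁ * Real.sin (P₁ p) * P₁ v| ≤ |Real.sin (P₁ p)| := by
      rw [abs_mul, abs_mul, aσ₁, one_mul]; exact mul_le_of_le_one_right (abs_nonneg _) hv1
    have b2 : |σ₂ * Real.sin (P₂ p) * P₂ v| ≤ |Real.sin (P₂ p)| := by
      rw [abs_mul, abs_mul, aσ₂, one_mul]; exact mul_le_of_le_one_right (abs_nonneg _) hv2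
    have b3 : |σ₃ * Real.sin (P₃ p) * P₃ v| ≤ |Real.sin (P₃ p)| := by
      rw [abs_mul, abs_mul, aσ₃, one_mul]; exact mul_le_of_le_one_right (abs_nonneg _) hv3
    have hsum : |-(σ₁ * Real.sin (P₁ p) * P₁ v) - σ₂ * Real.sin (P₂ p) * P₂ v - σ₃ * Real.sin (P₃ p) * P₃ v| ≤
        |Real.sin (P₁ p)| + |Real.sin (P₂ p)| + |Real.sin (P₃ p)| := by
      have t := abs_sub (-(σ₁ * Real.sin (P₁ p) * P₁ v) - σ₂ * Real.sin (P₂ p) * P₂ v) (σ₃ * Real.sin (P₃ p) * P₃ v)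
      have t' := abs_sub (-(σ₁ * Real.sin (P₁ p) * P₁ v)) (σ₂ * Real.sin (P₂ p) * P₂ v)
      rw [abs_neg] at t'
      linarith
    have hsq := pow_le_pow_left₀ (abs_nonneg _) hsum 2
    rw [sq_abs] at hsq
    have key3 : ∀ x y z : ℝ, (x + y + z) ^ 2 ≤ 3 * (x ^ 2 + y ^ 2 + z ^ 2) := fun x y z => by
      have e : 3 * (x ^ 2 + y ^ 2 + z ^ 2) - (x + y + z) ^ 2 = (x - y) ^ 2 + (y - z) ^ 2 + (x - z) ^ 2 := by ring
      have h : 0 ≤ (x - y) ^ 2 + (y - z) ^ 2 + (x - z) ^ 2 := by positivity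
      linarith
    have cs : (|Real.sin (P₁ p)| + |Real.sin (P₂ p)| + |Real.sin (P₃ p)|) ^ 2 ≤
        3 * (Real.sin (P₁ p) ^ 2 + Real.sin (P₂ p) ^ 2 + Real.sin (P₃ p) ^ 2) := by
      have := key3 |Real.sin (P₁ p)| |Real.sin (P₂ p)| |Real.sin (P₃ p)|
      rwa [sq_abs, sq_abs, sq_abs] at this
    rw [hdp]
    linarith
  · rw [hf2]
    have b1 : |σ₁ * P₁ v * (Real.cos (P₁ p) * P₁ w)| ≤ 1 := by
      rw [abs_mul, abs_mul, abs_mul, aσ₁, one_mul]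
      exact mul_le_one₀ hv1 (by positivity) (mul_le_one₀ hcos1 (abs_nonneg _) hw1)
    have b2 : |σ₂ * P₂ v * (Real.cos (P₂ p) * P₂ w)| ≤ 1 := by
      rw [abs_mul, abs_mul, abs_mul, aσ₂, one_mul]
      exact mul_le_one₀ hv2 (by positivity) (mul_le_one₀ hcos2 (abs_nonneg _) hw2)
    have b3 : |σ₃ * P₃ v * (Real.cos (P₃ p) * P₃ w)| ≤ 1 := by
      rw [abs_mul, abs_mul, abs_mul, aσ₃, one_mul]
      exact mul_le_one₀ hv3 (by positivity) (mul_le_one₀ hcos3 (abs_nonneg _) hw3)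
    have t := abs_sub (-(σ₁ * P₁ v * (Real.cos (P₁ p) * P₁ w)) - σ₂ * P₂ v * (Real.cos (P₂ p) * P₂ w))
      (σ₃ * P₃ v * (Real.cos (P₃ p) * P₃ w))
    have t' := abs_sub (-(σ₁ * P₁ v * (Real.cos (P₁ p) * P₁ w))) (σ₂ * P₂ v * (Real.cos (P₂ p) * P₂ w))
    rw [abs_neg] at t'
    have e : -(σ₁ * P₁ v) * (Real.cos (P₁ p) * P₁ w) = -(σ₁ * P₁ v * (Real.cos (P₁ p) * P₁ w)) := by ring
    rw [e]
    linarith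

/-! ### The five arguments -/

/-- **Registered sub-goal `cutoff_arguments` of stub B1b″ (item (C5)).** See the module docstring. [folklore] -/
theorem cutoff_arguments :
    ∀ ω₂ : ℝ, 0 < ω₂ → ∀ (A S₁ S₂ : ℝ × ℝ × ℝ → ℝ),
      (∀ p : ℝ × ℝ × ℝ, S₁ p = Real.sin ((p.2.1 - p.1) / 2)) →
      (∀ p : ℝ × ℝ × ℝ, S₂ p = Real.sin ((p.2.1 - p.2.2) / 2)) →
      (∀ p : ℝ × ℝ × ℝ, A p =
        8 * ((dispersion ω₂ p.1 * dispersion ω₂ p.2.2 +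
                dispersion ω₂ p.2.1 * dispersion ω₂ (p.1 + p.2.2 - p.2.1) + 2 * (ω₂ + 2)) *
              Real.cos ((p.1 + p.2.2) / 2) -
            4 * Real.cos ((p.2.1 - p.1) / 2) * Real.cos ((p.2.2 - p.2.1) / 2)) /
          ((dispersion ω₂ p.1 + dispersion ω₂ p.2.2 + dispersion ω₂ p.2.1 + dispersion ω₂ (p.1 + p.2.2 - p.2.1)) *
            (dispersion ω₂ p.1 * dispersion ω₂ p.2.2 +
              dispersion ω₂ p.2.1 * dispersion ω₂ (p.1 + p.2.2 - p.2.1)))) →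
      ∀ e : Fin 3 → ℝ × ℝ × ℝ,
        (∀ i, |(e i).1| ≤ 1 ∧ |(e i).2.1| ≤ 1 ∧ |(e i).2.2| ≤ 1 ∧ |(e i).2.1 - (e i).1| ≤ 1 ∧ |(e i).2.1 - (e i).2.2| ≤ 1) →
      ∃ K K₂ : ℝ, 0 ≤ K ∧ 0 ≤ K₂ ∧ ∀ ρ : ℝ × ℝ × ℝ → ℝ,
        (ρ = (fun p => S₁ p ^ 2 + A p ^ 2) ∨ ρ = (fun p => S₂ p ^ 2 + A p ^ 2) ∨ ρ = (fun p => S₁ p ^ 2 + S₂ p ^ 2) ∨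
          ρ = (fun p => (1 - Real.cos p.1) + (1 - Real.cos p.2.2) + (1 + Real.cos p.2.1)) ∨
          ρ = (fun p => (1 + Real.cos p.1) + (1 + Real.cos p.2.2) + (1 - Real.cos p.2.1))) →
        ContDiff ℝ 2 ρ ∧ (∀ p, 0 ≤ ρ p) ∧
          (∀ q : ℝ × ℝ × ℝ, ρ (q + (2 * Real.pi, 0, 0)) = ρ q) ∧ (∀ q : ℝ × ℝ × ℝ, ρ (q + (0, 2 * Real.pi, 0)) = ρ q) ∧
          (∀ q : ℝ × ℝ × ℝ, ρ (q + (0, 0, 2 * Real.pi)) = ρ q) ∧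
          (∀ (p : ℝ × ℝ × ℝ) (i j : Fin 3), (fderiv ℝ ρ p (e i)) ^ 2 ≤ K * ρ p ∧
            |fderiv ℝ (fun q => fderiv ℝ ρ q (e i)) p (e j)| ≤ K₂) := by
  intro ω₂ hω A S₁ S₂ hS₁ hS₂ hA e he
  -- uniform bounds on `A`, `S₁`, `S₂` and their first two derivatives along the frame
  obtain ⟨CA, hCA0, hCA⟩ := resonance_A_bounds hω hA e
  have hA2 : ContDiff ℝ 2 A := resonance_contDiff_A hω hA 2
  have h1 : ContDiff ℝ 2 S₁ := resonance_contDiff_S₁ hS₁ 2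
  have h2 : ContDiff ℝ 2 S₂ := resonance_contDiff_S₂ hS₂ 2
  set L₁ : ℝ × ℝ × ℝ →L[ℝ] ℝ :=
    (ContinuousLinearMap.fst ℝ ℝ ℝ).comp (ContinuousLinearMap.snd ℝ ℝ (ℝ × ℝ)) - ContinuousLinearMap.fst ℝ ℝ (ℝ × ℝ)
    with hL₁
  set L₂ : ℝ × ℝ × ℝ →L[ℝ] ℝ :=
    (ContinuousLinearMap.fst ℝ ℝ ℝ).comp (ContinuousLinearMap.snd ℝ ℝ (ℝ × ℝ)) -
      (ContinuousLinearMap.snd ℝ ℝ ℝ).comp (ContinuousLinearMap.snd ℝ ℝ (ℝ × ℝ)) with hL₂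
  have hL₁a : ∀ q : ℝ × ℝ × ℝ, L₁ q = q.2.1 - q.1 := fun q => by simp [hL₁]
  have hL₂a : ∀ q : ℝ × ℝ × ℝ, L₂ q = q.2.1 - q.2.2 := fun q => by simp [hL₂]
  have hS₁L : S₁ = fun q => Real.sin (L₁ q / 2) := funext fun q => by rw [hS₁, hL₁a]
  have hS₂L : S₂ = fun q => Real.sin (L₂ q / 2) := funext fun q => by rw [hS₂, hL₂a]
  set U := CA + 1 with hU
  have hU1 : 1 ≤ U := by rw [hU]; linarith
  have hCAU : CA ≤ U := by rw [hU]; linarith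
  -- per-point bound packages
  have bS₁ : ∀ (p : ℝ × ℝ × ℝ) (i j : Fin 3), |S₁ p| ≤ U ∧ |fderiv ℝ S₁ p (e i)| ≤ U ∧ |fderiv ℝ S₁ p (e j)| ≤ U ∧
      |fderiv ℝ (fun q => fderiv ℝ S₁ q (e i)) p (e j)| ≤ U := fun p i j => by
    obtain ⟨-, -, b0, b1, -, b2⟩ := halfSine_direction_bounds L₁ S₁ (fun q => fderiv ℝ S₁ q (e i)) (e i) (e j) p
      hS₁L rfl (by rw [hL₁a]; exact (he i).2.2.2.1) (by rw [hL₁a]; exact (he j).2.2.2.1)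
    obtain ⟨-, -, -, b1', -, -⟩ := halfSine_direction_bounds L₁ S₁ (fun q => fderiv ℝ S₁ q (e i)) (e i) (e i) p
      hS₁L rfl (by rw [hL₁a]; exact (he i).2.2.2.1) (by rw [hL₁a]; exact (he i).2.2.2.1)
    exact ⟨b0.trans hU1, b1'.trans hU1, b1.trans hU1, b2.trans hU1⟩
  have bS₂ : ∀ (p : ℝ × ℝ × ℝ) (i j : Fin 3), |S₂ p| ≤ U ∧ |fderiv ℝ S₂ p (e i)| ≤ U ∧ |fderiv ℝ S₂ p (e j)| ≤ U ∧
      |fderiv ℝ (fun q => fderiv ℝ S₂ q (e i)) p (e j)| ≤ U := fun p i j => by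
    obtain ⟨-, -, b0, b1, -, b2⟩ := halfSine_direction_bounds L₂ S₂ (fun q => fderiv ℝ S₂ q (e i)) (e i) (e j) p
      hS₂L rfl (by rw [hL₂a]; exact (he i).2.2.2.2) (by rw [hL₂a]; exact (he j).2.2.2.2)
    obtain ⟨-, -, -, b1', -, -⟩ := halfSine_direction_bounds L₂ S₂ (fun q => fderiv ℝ S₂ q (e i)) (e i) (e i) p
      hS₂L rfl (by rw [hL₂a]; exact (he i).2.2.2.2) (by rw [hL₂a]; exact (he i).2.2.2.2)
    exact ⟨b0.trans hU1, b1'.trans hU1, b1.trans hU1, b2.trans hU1⟩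
  have bA : ∀ (p : ℝ × ℝ × ℝ) (i j : Fin 3), |A p| ≤ U ∧ |fderiv ℝ A p (e i)| ≤ U ∧ |fderiv ℝ A p (e j)| ≤ U ∧
      |fderiv ℝ (fun q => fderiv ℝ A q (e i)) p (e j)| ≤ U := fun p i j =>
    ⟨(hCA p).1.trans hCAU, ((hCA p).2.1 i).trans hCAU, ((hCA p).2.1 j).trans hCAU, ((hCA p).2.2 i j).trans hCAU⟩
  -- shifts of the factors
  have hsh := floor_factor_shift (ω₂ := ω₂) hS₁ hS₂ hA
  refine ⟨8 * U ^ 2 + 6, 8 * U ^ 2 + 3, by positivity, by positivity, fun ρ hρ => ?_⟩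
  have hKge : (6 : ℝ) ≤ 8 * U ^ 2 + 6 := by nlinarith
  have hK₂ge : (3 : ℝ) ≤ 8 * U ^ 2 + 3 := by nlinarith
  have sq_case : ∀ {u w : ℝ × ℝ × ℝ → ℝ}, ContDiff ℝ 2 u → ContDiff ℝ 2 w →
      (∀ (p : ℝ × ℝ × ℝ) (i j : Fin 3), |u p| ≤ U ∧ |fderiv ℝ u p (e i)| ≤ U ∧ |fderiv ℝ u p (e j)| ≤ U ∧
        |fderiv ℝ (fun q => fderiv ℝ u q (e i)) p (e j)| ≤ U) →
      (∀ (p : ℝ × ℝ × ℝ) (i j : Fin 3), |w p| ≤ U ∧ |fderiv ℝ w p (e i)| ≤ U ∧ |fderiv ℝ w p (e j)| ≤ U ∧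
        |fderiv ℝ (fun q => fderiv ℝ w q (e i)) p (e j)| ≤ U) →
      ∀ (p : ℝ × ℝ × ℝ) (i j : Fin 3), (fderiv ℝ (fun q => u q ^ 2 + w q ^ 2) p (e i)) ^ 2 ≤
          (8 * U ^ 2 + 6) * (u p ^ 2 + w p ^ 2) ∧
        |fderiv ℝ (fun q => fderiv ℝ (fun r => u r ^ 2 + w r ^ 2) q (e i)) p (e j)| ≤ 8 * U ^ 2 + 3 := by
    intro u w hu hw bu bw p i j
    obtain ⟨u0, u1, u1', u2⟩ := bu p i j
    obtain ⟨w0, w1, w1', w2⟩ := bw p i j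
    obtain ⟨hnn, hd1, hd2⟩ := sqDist_bounds hu hw p (e i) (e j) u0 w0 u1 u1' w1 w1' u2 w2
    refine ⟨hd1.trans ?_, hd2.trans (by nlinarith)⟩
    exact mul_le_mul_of_nonneg_right (by nlinarith) hnn
  rcases hρ with h | h | h | h | h <;> subst h
  · refine ⟨(h1.pow 2).add (hA2.pow 2), fun p => by positivity, fun q => ?_, fun q => ?_, fun q => ?_,
      sq_case h1 hA2 bS₁ bA⟩
    · obtain ⟨⟨a, b, -⟩, -, -⟩ := hsh q; simp only [a, b]; ring
    · obtain ⟨-, ⟨a, b, -⟩, -⟩ := hsh q; simp only [a, b]; ring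
    · obtain ⟨-, -, ⟨a, b, -⟩⟩ := hsh q; simp only [a, b]; ring
  · refine ⟨(h2.pow 2).add (hA2.pow 2), fun p => by positivity, fun q => ?_, fun q => ?_, fun q => ?_,
      sq_case h2 hA2 bS₂ bA⟩
    · obtain ⟨⟨a, -, b⟩, -, -⟩ := hsh q; simp only [a, b]; ring
    · obtain ⟨-, ⟨a, -, b⟩, -⟩ := hsh q; simp only [a, b]; ring
    · obtain ⟨-, -, ⟨a, -, b⟩⟩ := hsh q; simp only [a, b]; ring
  · refine ⟨(h1.pow 2).add (h2.pow 2), fun p => by positivity, fun q => ?_, fun q => ?_, fun q => ?_,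
      sq_case h1 h2 bS₁ bS₂⟩
    · obtain ⟨⟨-, a, b⟩, -, -⟩ := hsh q; simp only [a, b]; ring
    · obtain ⟨-, ⟨-, a, b⟩, -⟩ := hsh q; simp only [a, b]; ring
    · obtain ⟨-, -, ⟨-, a, b⟩⟩ := hsh q; simp only [a, b]; ring
  · have hd : ∀ p : ℝ × ℝ × ℝ, (fun p : ℝ × ℝ × ℝ => (1 - Real.cos p.1) + (1 - Real.cos p.2.2) + (1 + Real.cos p.2.1)) p =
        3 + (-1) * Real.cos p.1 + (-1) * Real.cos p.2.2 + 1 * Real.cos p.2.1 := fun p => by simp only; ring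
    have hc := fun (p : ℝ × ℝ × ℝ) (i j : Fin 3) => cornerDist_bounds (-1) (-1) 1 (by norm_num) (by norm_num) (by norm_num)
      _ hd (e i) (e j) p ⟨(he i).1, (he i).2.1, (he i).2.2.1⟩ ⟨(he j).1, (he j).2.1, (he j).2.2.1⟩
    refine ⟨(hc 0 0 0).1, fun p => (hc p 0 0).2.1, fun q => ?_, fun q => ?_, fun q => ?_, fun p i j => ?_⟩
    · simp only [Prod.fst_add, Prod.snd_add, add_zero, Real.cos_add_two_pi]
    · simp only [Prod.fst_add, Prod.snd_add, add_zero, Real.cos_add_two_pi]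
    · simp only [Prod.fst_add, Prod.snd_add, add_zero, Real.cos_add_two_pi]
    · obtain ⟨-, hnn, hsq, h2⟩ := hc p i j
      exact ⟨hsq.trans (mul_le_mul_of_nonneg_right hKge hnn), h2.trans hK₂ge⟩
  · have hd : ∀ p : ℝ × ℝ × ℝ, (fun p : ℝ × ℝ × ℝ => (1 + Real.cos p.1) + (1 + Real.cos p.2.2) + (1 - Real.cos p.2.1)) p =
        3 + 1 * Real.cos p.1 + 1 * Real.cos p.2.2 + (-1) * Real.cos p.2.1 := fun p => by simp only; ring
    have hc := fun (p : ℝ × ℝ × ℝ) (i j : Fin 3) => cornerDist_bounds 1 1 (-1) (by norm_num) (by norm_num) (by norm_num)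
      _ hd (e i) (e j) p ⟨(he i).1, (he i).2.1, (he i).2.2.1⟩ ⟨(he j).1, (he j).2.1, (he j).2.2.1⟩
    refine ⟨(hc 0 0 0).1, fun p => (hc p 0 0).2.1, fun q => ?_, fun q => ?_, fun q => ?_, fun p i j => ?_⟩
    · simp only [Prod.fst_add, Prod.snd_add, add_zero, Real.cos_add_two_pi]
    · simp only [Prod.fst_add, Prod.snd_add, add_zero, Real.cos_add_two_pi]
    · simp only [Prod.fst_add, Prod.snd_add, add_zero, Real.cos_add_two_pi]
    · obtain ⟨-, hnn, hsq, h2⟩ := hc p i j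
      exact ⟨hsq.trans (mul_le_mul_of_nonneg_right hKge hnn), h2.trans hK₂ge⟩

/-- **Zeros of the gradient lie on the zero set of one of the five arguments.** [folklore] -/
theorem cutoff_arguments_zero :
    ∀ ω₂ : ℝ, 0 < ω₂ → ∀ (A S₁ S₂ : ℝ × ℝ × ℝ → ℝ),
      (∀ p : ℝ × ℝ × ℝ, S₁ p = Real.sin ((p.2.1 - p.1) / 2)) →
      (∀ p : ℝ × ℝ × ℝ, S₂ p = Real.sin ((p.2.1 - p.2.2) / 2)) →
      (∀ p : ℝ × ℝ × ℝ, A p =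
        8 * ((dispersion ω₂ p.1 * dispersion ω₂ p.2.2 +
                dispersion ω₂ p.2.1 * dispersion ω₂ (p.1 + p.2.2 - p.2.1) + 2 * (ω₂ + 2)) *
              Real.cos ((p.1 + p.2.2) / 2) -
            4 * Real.cos ((p.2.1 - p.1) / 2) * Real.cos ((p.2.2 - p.2.1) / 2)) /
          ((dispersion ω₂ p.1 + dispersion ω₂ p.2.2 + dispersion ω₂ p.2.1 + dispersion ω₂ (p.1 + p.2.2 - p.2.1)) *
            (dispersion ω₂ p.1 * dispersion ω₂ p.2.2 +
              dispersion ω₂ p.2.1 * dispersion ω₂ (p.1 + p.2.2 - p.2.1)))) →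
      ∀ p : ℝ × ℝ × ℝ,
        (fderiv ℝ (fun q : ℝ × ℝ × ℝ => resonanceFn ω₂ q.1 q.2.2 q.2.1) p (1, 0, 0)) ^ 2 +
            (fderiv ℝ (fun q : ℝ × ℝ × ℝ => resonanceFn ω₂ q.1 q.2.2 q.2.1) p (0, 1, 0)) ^ 2 +
            (fderiv ℝ (fun q : ℝ × ℝ × ℝ => resonanceFn ω₂ q.1 q.2.2 q.2.1) p (0, 0, 1)) ^ 2 = 0 →
        S₁ p ^ 2 + A p ^ 2 = 0 ∨ S₂ p ^ 2 + A p ^ 2 = 0 ∨ S₁ p ^ 2 + S₂ p ^ 2 = 0 ∨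
          (1 - Real.cos p.1) + (1 - Real.cos p.2.2) + (1 + Real.cos p.2.1) = 0 ∨
          (1 + Real.cos p.1) + (1 + Real.cos p.2.2) + (1 - Real.cos p.2.1) = 0 := by
  intro ω₂ hω A S₁ S₂ hS₁ hS₂ hA p hD
  by_cases h₁ : (1 - Real.cos p.1) + (1 - Real.cos p.2.2) + (1 + Real.cos p.2.1) = 0
  · exact Or.inr (Or.inr (Or.inr (Or.inl h₁)))
  by_cases h₂ : (1 + Real.cos p.1) + (1 + Real.cos p.2.2) + (1 - Real.cos p.2.1) = 0
  · exact Or.inr (Or.inr (Or.inr (Or.inr h₂)))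
  -- away from the corners the floor forces `μ(p) = 0`
  have c1 := Real.cos_le_one p.1
  have c2 := Real.cos_le_one p.2.2
  have c3 := Real.cos_le_one p.2.1
  have c1' := Real.neg_one_le_cos p.1
  have c2' := Real.neg_one_le_cos p.2.2
  have c3' := Real.neg_one_le_cos p.2.1
  have hpos₁ : 0 < (1 - Real.cos p.1) + (1 - Real.cos p.2.2) + (1 + Real.cos p.2.1) :=
    lt_of_le_of_ne (by linarith) (Ne.symm h₁)
  have hpos₂ : 0 < (1 + Real.cos p.1) + (1 + Real.cos p.2.2) + (1 - Real.cos p.2.1) :=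
    lt_of_le_of_ne (by linarith) (Ne.symm h₂)
  obtain ⟨c, hc, hfl⟩ := resonance_gradient_floor ω₂ hω A S₁ S₂ hS₁ hS₂ hA _ (lt_min hpos₁ hpos₂)
  have h := hfl p (min_le_left _ _) (min_le_right _ _)
  rw [hD] at h
  have hμ0 : A p ^ 2 * S₁ p ^ 2 + A p ^ 2 * S₂ p ^ 2 + S₁ p ^ 2 * S₂ p ^ 2 = 0 := by
    have hnn : 0 ≤ A p ^ 2 * S₁ p ^ 2 + A p ^ 2 * S₂ p ^ 2 + S₁ p ^ 2 * S₂ p ^ 2 := by positivity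
    have := mul_nonneg hc.le hnn
    have hle : c * (A p ^ 2 * S₁ p ^ 2 + A p ^ 2 * S₂ p ^ 2 + S₁ p ^ 2 * S₂ p ^ 2) ≤ 0 := h
    have heq : c * (A p ^ 2 * S₁ p ^ 2 + A p ^ 2 * S₂ p ^ 2 + S₁ p ^ 2 * S₂ p ^ 2) = 0 := le_antisymm hle this
    rcases mul_eq_zero.1 heq with h0 | h0
    · exact absurd h0 hc.ne'
    · exact h0
  have n1 : 0 ≤ A p ^ 2 * S₁ p ^ 2 := by positivity
  have n2 : 0 ≤ A p ^ 2 * S₂ p ^ 2 := by positivity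
  have n3 : 0 ≤ S₁ p ^ 2 * S₂ p ^ 2 := by positivity
  have t1 : A p ^ 2 * S₁ p ^ 2 = 0 := le_antisymm (by linarith) n1
  have t2 : A p ^ 2 * S₂ p ^ 2 = 0 := le_antisymm (by linarith) n2
  have t3 : S₁ p ^ 2 * S₂ p ^ 2 = 0 := le_antisymm (by linarith) n3
  rcases mul_eq_zero.1 t3 with hs1 | hs2
  · -- `S₁ = 0`
    rcases mul_eq_zero.1 t2 with ha | hs2
    · exact Or.inl (by rw [hs1, ha]; ring)
    · exact Or.inr (Or.inr (Or.inl (by rw [hs1, hs2]; ring)))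
  · rcases mul_eq_zero.1 t1 with ha | hs1
    · exact Or.inr (Or.inl (by rw [hs2, ha]; ring))
    · exact Or.inr (Or.inr (Or.inl (by rw [hs1, hs2]; ring)))

end Summit.AtomisticToContinuum.FouriersLaw.Theorems.DrudeDissolution.KineticPolymerGasOnTheTimeAxis

end
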